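import Summits.FinalStateConjecture.FinalStateConjecture.Theorems.LaminatedThresholdCagedCombReduction
import Summits.FinalStateConjecture.FinalStateConjecture.Theorems.LaminatedThresholdCombLemmaAdapted

/-!
# Crux `LaminatedThreshold` — line `SketchIdeator1` reshaped: CAGED COMB SKELETON (line lead, 2026-08-17)

Crux item `stmt-FinalStateConjecture-16893`, decl (FIXED, concluded BY NAME in `LaminatedThreshold_of`):
`Summit.FinalStateConjecture.FinalStateConjecture.Theses.LaminatedThreshold.LaminatedThreshold`
(REFUTATION route `route-FinalStateConjecture-LaminatedThreshold`, crux A; `closes :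
LaminatedThreshold → TameExitsLocalise → ¬ FinalStateConjecture`).

## The cut (ideator-1 cards equivariant-cage / mixed-branches / energy-cones over the re-typed comb line)

`LaminatedThreshold ⇐ comb_lemma_adapted → stub_cagedCombCarrier → stub_nakedNotSettled`.

* `comb_lemma_adapted` — Stub 1, ABSTRACT (Mathlib only): the comb lemma in adapted coordinates
  (= refuted `stub_combLemma` + invariance of the `t`-axis), seat 1's registered signature VERBATIM; its
  proof LANDED as `Theorems/LaminatedThresholdCombLemmaAdapted.lean` (p157552, `Comb.comb_lemma_adapted`, on top
  of the cone-field λ-lemma `Comb.comb_abstract`): this stub is CLOSED (no `sorry`; reshape 1, 2026-08-17).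
* `stub_cagedCombCarrier` — Stub 2, THE PHYSICS (open problem): the adapted vacuum comb carrier of
  `Theorems/LaminatedThresholdAdaptedCombReduction.lean` (admissible `d⋆`; a Banach space `E`; a `C¹`
  period map `T` of `E × ℝ` fixing `0` with block linearisation `(S, μ)`, `1 < μ`, `t`-axis invariant;
  a reading map `π` of data into `E × ℝ`, `π d⋆ = 0`, continuous along every jointly smooth compactly
  supported admissible family; transverse `C¹` seed sheets on both sides of the axis at every scale; and
  the dictionary "orbit stays small, or lands on a seed sheet ⇒ every MGHD of the member carries a visible
  future-incomplete null ray") with ONE change: the contraction `‖S‖ < 1` of the complement of the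
  unstable direction is weakened to EVENTUAL contraction `∃ N, ‖S ^ (N+1)‖ < 1` (spectral radius `< 1`,
  norm-free). That is exactly what the cage delivers (card equivariant-cage: build the saddle in the
  `U(1) × Z₂`-symmetric flow, where it is a 2+1 Einstein–wave-map problem carrying all the numerical
  evidence, and control the non-symmetric directions by uniform decay of the `m ≠ 0` modes; the cage
  lemma gives `‖S ^ n‖ ≤ (‖P‖ + ‖1 - P‖) θ ^ n`, `P` the symmetrising projection — only an iterate contracts).
* `stub_nakedNotSettled` — Stub 3 (L–XL, shared verbatim with lines `birth` / `heteroclinic_comb`): a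
  maximal vacuum Cauchy development of an admissible datum carrying a visible future-incomplete null ray
  is not both complete-`𝓘⁺` (sojourn form) and settled (sub-extremal, ray-closed, exhaustive,
  future-oriented `C²` Kerr decomposition).

Composition `LaminatedThreshold_of` (kernel-checked, no `sorry` of its own): a caged carrier with period
map `T` yields an adapted carrier with period map `T^[N+1]` (`adaptedCombCarrier_of_cagedCombCarrier`:
the iterate is `C¹` on a shrunken ball, fixes `0`, has linearisation `(S ^ (N+1), μ ^ (N+1))`, keeps the
axis invariant there; its orbit trichotomy implies `T`'s once the smallness radius is shrunk so that the
first `N` iterates of `T` map it into the carrier's radius, so the nakedness dictionary is inherited), and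
the landed `laminatedThreshold_of_adaptedComb_verbatim` (p156269) concludes the crux BY NAME — all LANDED as
`Theorems/LaminatedThresholdCagedCombReduction.lean` (p158743, `CagedComb.laminatedThreshold_of_cagedComb_verbatim`),
imported here. Open stubs after reshape 1: Stub 2 (physics), Stub 3 (causal geometry); seat 0's one-stub forms
(`Theorems/LaminatedThresholdCagedCarrierTransfer.lean`: caged carrier with the ¬SettlesT2 / sojourn dictionary)
fold Stub 3 into the carrier's dictionary — kept separate here on purpose (physics | causal geometry).

## Disproof used
No `Disproof.lean` exists for this crux (payload `disproof_path` absent from the jail; `ledger crux ls`: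
none). Honoured instead: `Negative.stub_combLemma_false` (p151916) and `Negative.coneCombLemma_false`
(p154871) — seeds must sit on the `T`-invariant axis: Stub 1 carries the axis clause, Stub 2 hands over
ADAPTED coordinates; the `C¹` carrier is kept (the cone-field weakening is seat 1's `comb_abstract`).
-/

noncomputable section

-- the doubled `FinalStateConjecture.FinalStateConjecture` path component trips dupNamespace
set_option linter.dupNamespace false

namespace Summit.FinalStateConjecture.FinalStateConjecture.Cruxes.LaminatedThreshold.CagedCombLine

open Set Filter Metric Function Topology TopologicalSpace
open scoped Manifold ContDiff
open Literature.Geometry.Lorentzian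
open Summit.FinalStateConjecture.FinalStateConjecture.Theses.LaminatedThreshold
open Summit.FinalStateConjecture.FinalStateConjecture.Theorems.LaminatedThreshold

/-! ## §1 The three statements of the line (named; nothing here is a route item) -/

/-- **Stub 1 statement — the comb lemma in adapted coordinates** (seat 1's registered `comb_lemma_adapted`,
verbatim). [folklore] -/
def CombLemmaAdapted : Prop :=
  ∀ (E : Type) [NormedAddCommGroup E] [NormedSpace ℝ E] [CompleteSpace E] (T : E × ℝ → E × ℝ) (S : E →L[ℝ] E) (μ r₀ : ℝ), T 0 = 0 → 0 < r₀ → ContDiffOn ℝ 1 T (Metric.ball 0 r₀) → HasFDerivAt T ((S.comp (ContinuousLinearMap.fst ℝ E ℝ)).prod (μ • ContinuousLinearMap.snd ℝ E ℝ)) 0 → ‖S‖ < 1 → 1 < μ → (∀ t : ℝ, |t| < r₀ → (T ((0 : E), t)).1 = 0) → ∃ r₁ : ℝ, 0 < r₁ ∧ ∀ (σ₁ σ₂ : ℝ) (G₁ G₂ : E × ℝ → ℝ), 0 < σ₁ ∧ σ₁ < r₁ ∧ -r₁ < σ₂ ∧ σ₂ < 0 ∧ (∃ r' : ℝ, 0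 < r' ∧ ContDiffOn ℝ 1 G₁ (Metric.ball ((0 : E), σ₁) r') ∧ ContDiffOn ℝ 1 G₂ (Metric.ball ((0 : E), σ₂) r')) ∧ G₁ ((0 : E), σ₁) = 0 ∧ fderiv ℝ G₁ ((0 : E), σ₁) ((0 : E), (1 : ℝ)) ≠ 0 ∧ G₂ ((0 : E), σ₂) = 0 ∧ fderiv ℝ G₂ ((0 : E), σ₂) ((0 : E), (1 : ℝ)) ≠ 0 → ∀ ε : ℝ, 0 < ε → ∃ ρ : ℝ, 0 < ρ ∧ ∃ (Φ : E × ℝ → ℝ) (K : Set ℝ), Φ 0 = 0 ∧ (0 : ℝ) ∈ K ∧ (∀ η : ℝ, 0 < η → (K ∩ Set.Ioo (0 - η) 0).Nonempty ∧ (K ∩ Set.Ioo 0 (0 + η)).Nonempty) ∧ ContinuousOn Φ (Metric.ball 0 ρ) ∧ ∀ p ∈ Metric.ball (0 : E × ℝ) ρ, Φ p ∈ K → ((∀ n : ℕ, T^[n] p ∈ Metric.ball (0 : E × ℝ) ε) ∨ (∃ n : ℕ, T^[n] p ∈ Metric.ball ((0 : E), σ₁) ε ∧ G₁ (T^[n]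 p) = 0) ∨ (∃ n : ℕ, T^[n] p ∈ Metric.ball ((0 : E), σ₂) ε ∧ G₂ (T^[n] p) = 0))

/-- **Stub 2 statement — the CAGED vacuum comb carrier** (the adapted carrier with `‖S‖ < 1` weakened to
`∃ N, ‖S ^ (N+1)‖ < 1`). [cite: BaumgarteEtAl2023] [cite: HawkingEllis1973CUP, §9.2, p. 311] -/
def CagedCombCarrier : Prop :=
  ∃ (X : Type) (_ : TopologicalSpace X) (_ : ChartedSpace Literature.Geometry.Lorentzian.E3 X) (_ : IsManifold (𝓡 3) ((⊤ : ℕ∞) : WithTop ℕ∞) X) (_ : T2Space X) (_ : SecondCountableTopology X) (_ : ConnectedSpace X) (dstar : Literature.Geometry.Lorentzian.InitialDataSet (𝓡 3) X) (E : Type) (_ : NormedAddCommGroup E) (_ : NormedSpace ℝ E) (_ : CompleteSpace E) (T : E × ℝ → E × ℝ) (S : E →L[ℝ] E) (μ r₀ : ℝ) (π : Literature.Geometry.Lorentzian.InitialDataSet (𝓡 3) X → E × ℝ), dstar ∈ Literature.Geometry.Lorentzian.admissibleVacuumData X ∧ T 0 = 0 ∧ 0 < r₀ ∧ ContDiffOn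 ℝ 1 T (Metric.ball 0 r₀) ∧ HasFDerivAt T ((S.comp (ContinuousLinearMap.fst ℝ E ℝ)).prod (μ • ContinuousLinearMap.snd ℝ E ℝ)) 0 ∧ (∃ N : ℕ, ‖S ^ (N + 1)‖ < 1) ∧ 1 < μ ∧ (∀ t : ℝ, |t| < r₀ → (T ((0 : E), t)).1 = 0) ∧ π dstar = 0 ∧ (∀ F : EuclideanSpace ℝ (Fin 1) → Literature.Geometry.Lorentzian.InitialDataSet (𝓡 3) X, Literature.Geometry.Lorentzian.InitialDataSet.IsSmoothDataFamily 1 F → F 0 = dstar → (∀ c, F c ∈ Literature.Geometry.Lorentzian.admissibleVacuumData X) → (∃ C : Set X, IsCompact C ∧ ∀ c, ∀ x ∉ C, (F c).h.inner x = dstar.h.inner x ∧ (F c).k x = dstar.k x) → ∃ δ : ℝ, 0 < δ ∧ ContinuousOn (fun c ↦ π (F c)) (Metric.ball 0 δ)) ∧ ∀ r : ℝ, 0 < r → ∃ (σ₁ σ₂ ε₂ : ℝ) (G₁ G₂ : E × ℝ → ℝ), 0 < ε₂ ∧ (0 < σ₁ ∧ σ₁ < r ∧ -r < σ₂ ∧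 σ₂ < 0 ∧ (∃ r' : ℝ, 0 < r' ∧ ContDiffOn ℝ 1 G₁ (Metric.ball ((0 : E), σ₁) r') ∧ ContDiffOn ℝ 1 G₂ (Metric.ball ((0 : E), σ₂) r')) ∧ G₁ ((0 : E), σ₁) = 0 ∧ fderiv ℝ G₁ ((0 : E), σ₁) ((0 : E), (1 : ℝ)) ≠ 0 ∧ G₂ ((0 : E), σ₂) = 0 ∧ fderiv ℝ G₂ ((0 : E), σ₂) ((0 : E), (1 : ℝ)) ≠ 0) ∧ ∀ F : EuclideanSpace ℝ (Fin 1) → Literature.Geometry.Lorentzian.InitialDataSet (𝓡 3) X, Literature.Geometry.Lorentzian.InitialDataSet.IsSmoothDataFamily 1 F → F 0 = dstar → (∀ c, F c ∈ Literature.Geometry.Lorentzian.admissibleVacuumData X) → (∃ C : Set X, IsCompact C ∧ ∀ c, ∀ x ∉ C, (F c).h.inner x = dstar.h.inner x ∧ (F c).k x = dstar.k x) → ∃ δ : ℝ, 0 < δ ∧ ∀ c ∈ Metric.ball (0 : EuclideanSpace ℝ (Fin 1)) δ, ((∀ n : ℕ, T^[n] (π (F c)) ∈ Metric.ball (0 :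 E × ℝ) ε₂) ∨ (∃ n : ℕ, T^[n] (π (F c)) ∈ Metric.ball ((0 : E), σ₁) ε₂ ∧ G₁ (T^[n] (π (F c))) = 0) ∨ (∃ n : ℕ, T^[n] (π (F c)) ∈ Metric.ball ((0 : E), σ₂) ε₂ ∧ G₂ (T^[n] (π (F c))) = 0)) → ∀ 𝒟 : Literature.Geometry.Lorentzian.VacuumCauchyDevelopment (F c), 𝒟.IsMaximal → ∀ [𝒟.metric.HasLeviCivita], ∃ (γ : ℝ → 𝒟.carrier) (dom : Set ℝ), (Literature.Geometry.Lorentzian.IsMaximalGeodesicOn 𝒟.metric.leviCivita γ dom ∧ (0 : ℝ) ∈ dom ∧ BddAbove dom ∧ (∀ t ∈ dom, 𝒟.metric.IsNull (Literature.Geometry.Lorentzian.velocity (𝓡 4) γ t) ∧ 𝒟.timeOrientation.IsFutureDirected (Literature.Geometry.Lorentzian.velocity (𝓡 4) γ t)) ∧ (∀ t ∈ dom, 0 ≤ t → (∃ (p : X) (δ' : ℝ → 𝒟.carrier) (s : Set ℝ), 𝒟.metric.IsNormalisedNullRayFrom 𝒟.timeOrientation 𝒟.embed 𝒟.normal p δ'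 s ∧ ¬ BddAbove s ∧ γ t ∈ 𝒟.metric.chronologicalPast 𝒟.timeOrientation (δ' '' (s ∩ Set.Ici 0)))))

/-- **Stub 3 statement — naked developments are exceptional for the final-state property** (registered
`stub_nakedNotSettled`, verbatim). [cite: HawkingEllis1973CUP, §9.2, Prop. 9.2.1] [cite: DafermosLuk2017, Conjecture 1] -/
def NakedNotSettled : Prop :=
  ∀ (X : Type) [TopologicalSpace X] [ChartedSpace Literature.Geometry.Lorentzian.E3 X] [IsManifold (𝓡 3) ((⊤ : ℕ∞) : WithTop ℕ∞) X] [T2Space X] [SecondCountableTopology X] [ConnectedSpace X], ∀ D ∈ Literature.Geometry.Lorentzian.admissibleVacuumData X, ∀ 𝒟 : Literature.Geometry.Lorentzian.VacuumCauchyDevelopment D, 𝒟.IsMaximal → (∀ [𝒟.metric.HasLeviCivita], ∃ (γ : ℝ → 𝒟.carrier) (dom : Set ℝ), (Literature.Geometry.Lorentzian.IsMaximalGeodesicOn 𝒟.metric.leviCivita γ dom ∧ (0 : ℝ) ∈ dom ∧ BddAbove dom ∧ (∀ t ∈ dom, 𝒟.metric.IsNull (Literature.Geometry.Lorentzian.velocity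 (𝓡 4) γ t) ∧ 𝒟.timeOrientation.IsFutureDirected (Literature.Geometry.Lorentzian.velocity (𝓡 4) γ t)) ∧ (∀ t ∈ dom, 0 ≤ t → (∃ (p : X) (δ' : ℝ → 𝒟.carrier) (s : Set ℝ), 𝒟.metric.IsNormalisedNullRayFrom 𝒟.timeOrientation 𝒟.embed 𝒟.normal p δ' s ∧ ¬ BddAbove s ∧ γ t ∈ 𝒟.metric.chronologicalPast 𝒟.timeOrientation (δ' '' (s ∩ Set.Ici 0)))))) → ¬ (Summit.FinalStateConjecture.HasCompleteNullInfinity 𝒟.toCauchyDevelopment ∧ ∃ (O : Set 𝒟.carrier) (d : Literature.Geometry.Lorentzian.FinalStateDecomposition 𝒟.toSpacetime O 2), (∀ i, Literature.Geometry.Lorentzian.Kerr.IsSubextremal (d.mass i) (d.spin i)) ∧ O = Summit.FinalStateConjecture.exteriorOf 𝒟.toCauchyDevelopment d.charted ∧ Summit.FinalStateConjecture.RaysStayInClosure 𝒟.toCauchyDevelopment O ∧ Summit.FinalStateConjecture.HasExhaustiveCharts d ∧ Summit.FinalStateConjecture.IsFutureOriented d)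

/-! ### Statements of the registered stubs, under the stub names
The skeleton audit reads the hypotheses of `LaminatedThreshold_of` BY NAME: each head is a declared stub. -/
namespace Goal

/-- Statement of `comb_lemma_adapted`. -/
abbrev comb_lemma_adapted : Prop := CombLemmaAdapted
/-- Statement of `stub_cagedCombCarrier`. -/
abbrev stub_cagedCombCarrier : Prop := CagedCombCarrier
/-- Statement of `stub_nakedNotSettled`. -/
abbrev stub_nakedNotSettled : Prop := NakedNotSettled

end Goal

/-! ## §2 Registered stubs (Stub 1 closed; the two `sorry`s of the file are Stubs 2 and 3), stated EXPANDED -/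

/-- **Stub 1** (abstract) — CLOSED by seat 1's landed `Comb.comb_lemma_adapted` (p157552). [folklore] -/
theorem comb_lemma_adapted : ∀ (E : Type) [NormedAddCommGroup E] [NormedSpace ℝ E] [CompleteSpace E] (T : E × ℝ → E × ℝ) (S : E →L[ℝ] E) (μ r₀ : ℝ), T 0 = 0 → 0 < r₀ → ContDiffOn ℝ 1 T (Metric.ball 0 r₀) → HasFDerivAt T ((S.comp (ContinuousLinearMap.fst ℝ E ℝ)).prod (μ • ContinuousLinearMap.snd ℝ E ℝ)) 0 → ‖S‖ < 1 → 1 < μ → (∀ t : ℝ, |t| < r₀ → (T ((0 : E), t)).1 = 0) → ∃ r₁ : ℝ, 0 < r₁ ∧ ∀ (σ₁ σ₂ : ℝ) (G₁ G₂ : E × ℝ → ℝ), 0 < σ₁ ∧ σ₁ < r₁ ∧ -r₁ < σ₂ ∧ σ₂ < 0 ∧ (∃ r' : ℝ, 0 < r' ∧ ContDiffOn ℝ 1 G₁ (Metric.ball ((0 : E), σ₁) r') ∧ ContDiffOn ℝ 1 G₂ (Metric.ball ((0 : E), σ₂) r')) ∧ G₁ ((0 : E), σ₁) = 0 ∧ fderiv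 ℝ G₁ ((0 : E), σ₁) ((0 : E), (1 : ℝ)) ≠ 0 ∧ G₂ ((0 : E), σ₂) = 0 ∧ fderiv ℝ G₂ ((0 : E), σ₂) ((0 : E), (1 : ℝ)) ≠ 0 → ∀ ε : ℝ, 0 < ε → ∃ ρ : ℝ, 0 < ρ ∧ ∃ (Φ : E × ℝ → ℝ) (K : Set ℝ), Φ 0 = 0 ∧ (0 : ℝ) ∈ K ∧ (∀ η : ℝ, 0 < η → (K ∩ Set.Ioo (0 - η) 0).Nonempty ∧ (K ∩ Set.Ioo 0 (0 + η)).Nonempty) ∧ ContinuousOn Φ (Metric.ball 0 ρ) ∧ ∀ p ∈ Metric.ball (0 : E × ℝ) ρ, Φ p ∈ K → ((∀ n : ℕ, T^[n] p ∈ Metric.ball (0 : E × ℝ) ε) ∨ (∃ n : ℕ, T^[n] p ∈ Metric.ball ((0 : E), σ₁) ε ∧ G₁ (T^[n] p) = 0) ∨ (∃ n : ℕ, T^[n] p ∈ Metric.ball ((0 : E), σ₂) ε ∧ G₂ (T^[n] p) = 0)) :=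
  Comb.comb_lemma_adapted

/-- **Stub 2** (open-problem physics): the caged vacuum comb carrier — see `CagedCombCarrier`.
[cite: BaumgarteEtAl2023] [cite: HawkingEllis1973CUP, §9.2, p. 311] -/
theorem stub_cagedCombCarrier : ∃ (X : Type) (_ : TopologicalSpace X) (_ : ChartedSpace Literature.Geometry.Lorentzian.E3 X) (_ : IsManifold (𝓡 3) ((⊤ : ℕ∞) : WithTop ℕ∞) X) (_ : T2Space X) (_ : SecondCountableTopology X) (_ : ConnectedSpace X) (dstar : Literature.Geometry.Lorentzian.InitialDataSet (𝓡 3) X) (E : Type) (_ : NormedAddCommGroup E) (_ : NormedSpace ℝ E) (_ : CompleteSpace E) (T : E × ℝ → E × ℝ) (S : E →L[ℝ] E) (μ r₀ : ℝ) (π : Literature.Geometry.Lorentzian.InitialDataSet (𝓡 3) X → E × ℝ), dstar ∈ Literature.Geometry.Lorentzian.admissibleVacuumData X ∧ T 0 = 0 ∧ 0 < r₀ ∧ ContDiffOn ℝ 1 T (Metric.ball 0 r₀) ∧ HasFDerivAt T ((S.comp (ContinuousLinearMap.fst ℝ E ℝ)).prod (μ • ContinuousLinearMap.snd ℝ E ℝ))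 0 ∧ (∃ N : ℕ, ‖S ^ (N + 1)‖ < 1) ∧ 1 < μ ∧ (∀ t : ℝ, |t| < r₀ → (T ((0 : E), t)).1 = 0) ∧ π dstar = 0 ∧ (∀ F : EuclideanSpace ℝ (Fin 1) → Literature.Geometry.Lorentzian.InitialDataSet (𝓡 3) X, Literature.Geometry.Lorentzian.InitialDataSet.IsSmoothDataFamily 1 F → F 0 = dstar → (∀ c, F c ∈ Literature.Geometry.Lorentzian.admissibleVacuumData X) → (∃ C : Set X, IsCompact C ∧ ∀ c, ∀ x ∉ C, (F c).h.inner x = dstar.h.inner x ∧ (F c).k x = dstar.k x) → ∃ δ : ℝ, 0 < δ ∧ ContinuousOn (fun c ↦ π (F c)) (Metric.ball 0 δ)) ∧ ∀ r : ℝ, 0 < r → ∃ (σ₁ σ₂ ε₂ : ℝ) (G₁ G₂ : E × ℝ → ℝ), 0 < ε₂ ∧ (0 < σ₁ ∧ σ₁ < r ∧ -r < σ₂ ∧ σ₂ < 0 ∧ (∃ r' : ℝ, 0 < r' ∧ ContDiffOn ℝ 1 G₁ (Metric.ball ((0 : E), σ₁) r') ∧ ContDiffOn ℝ 1 G₂ (Metric.ball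 ((0 : E), σ₂) r')) ∧ G₁ ((0 : E), σ₁) = 0 ∧ fderiv ℝ G₁ ((0 : E), σ₁) ((0 : E), (1 : ℝ)) ≠ 0 ∧ G₂ ((0 : E), σ₂) = 0 ∧ fderiv ℝ G₂ ((0 : E), σ₂) ((0 : E), (1 : ℝ)) ≠ 0) ∧ ∀ F : EuclideanSpace ℝ (Fin 1) → Literature.Geometry.Lorentzian.InitialDataSet (𝓡 3) X, Literature.Geometry.Lorentzian.InitialDataSet.IsSmoothDataFamily 1 F → F 0 = dstar → (∀ c, F c ∈ Literature.Geometry.Lorentzian.admissibleVacuumData X) → (∃ C : Set X, IsCompact C ∧ ∀ c, ∀ x ∉ C, (F c).h.inner x = dstar.h.inner x ∧ (F c).k x = dstar.k x) → ∃ δ : ℝ, 0 < δ ∧ ∀ c ∈ Metric.ball (0 : EuclideanSpace ℝ (Fin 1)) δ, ((∀ n : ℕ, T^[n] (π (F c)) ∈ Metric.ball (0 : E × ℝ) ε₂) ∨ (∃ n : ℕ, T^[n] (π (F c)) ∈ Metric.ball ((0 : E), σ₁) ε₂ ∧ G₁ (T^[n] (π (F c))) = 0) ∨ (∃ n : ℕ,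 T^[n] (π (F c)) ∈ Metric.ball ((0 : E), σ₂) ε₂ ∧ G₂ (T^[n] (π (F c))) = 0)) → ∀ 𝒟 : Literature.Geometry.Lorentzian.VacuumCauchyDevelopment (F c), 𝒟.IsMaximal → ∀ [𝒟.metric.HasLeviCivita], ∃ (γ : ℝ → 𝒟.carrier) (dom : Set ℝ), (Literature.Geometry.Lorentzian.IsMaximalGeodesicOn 𝒟.metric.leviCivita γ dom ∧ (0 : ℝ) ∈ dom ∧ BddAbove dom ∧ (∀ t ∈ dom, 𝒟.metric.IsNull (Literature.Geometry.Lorentzian.velocity (𝓡 4) γ t) ∧ 𝒟.timeOrientation.IsFutureDirected (Literature.Geometry.Lorentzian.velocity (𝓡 4) γ t)) ∧ (∀ t ∈ dom, 0 ≤ t → (∃ (p : X) (δ' : ℝ → 𝒟.carrier) (s : Set ℝ), 𝒟.metric.IsNormalisedNullRayFrom 𝒟.timeOrientation 𝒟.embed 𝒟.normal p δ' s ∧ ¬ BddAbove s ∧ γ t ∈ 𝒟.metric.chronologicalPast 𝒟.timeOrientation (δ' '' (s ∩ Set.Ici 0))))) := by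
  sorry

/-- **Stub 3** (L–XL): naked developments are exceptional for the final-state property — see
`NakedNotSettled`. [cite: HawkingEllis1973CUP, §9.2, Prop. 9.2.1] [cite: DafermosLuk2017, Conjecture 1] -/
theorem stub_nakedNotSettled : ∀ (X : Type) [TopologicalSpace X] [ChartedSpace Literature.Geometry.Lorentzian.E3 X] [IsManifold (𝓡 3) ((⊤ : ℕ∞) : WithTop ℕ∞) X] [T2Space X] [SecondCountableTopology X] [ConnectedSpace X], ∀ D ∈ Literature.Geometry.Lorentzian.admissibleVacuumData X, ∀ 𝒟 : Literature.Geometry.Lorentzian.VacuumCauchyDevelopment D, 𝒟.IsMaximal → (∀ [𝒟.metric.HasLeviCivita], ∃ (γ : ℝ → 𝒟.carrier) (dom : Set ℝ), (Literature.Geometry.Lorentzian.IsMaximalGeodesicOn 𝒟.metric.leviCivita γ dom ∧ (0 : ℝ) ∈ dom ∧ BddAbove dom ∧ (∀ t ∈ dom, 𝒟.metric.IsNull (Literature.Geometry.Lorentzian.velocity (𝓡 4) γ t) ∧ 𝒟.timeOrientation.IsFutureDirected (Literature.Geometry.Lorentzian.velocity (𝓡 4) γ t)) ∧ (∀ t ∈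 dom, 0 ≤ t → (∃ (p : X) (δ' : ℝ → 𝒟.carrier) (s : Set ℝ), 𝒟.metric.IsNormalisedNullRayFrom 𝒟.timeOrientation 𝒟.embed 𝒟.normal p δ' s ∧ ¬ BddAbove s ∧ γ t ∈ 𝒟.metric.chronologicalPast 𝒟.timeOrientation (δ' '' (s ∩ Set.Ici 0)))))) → ¬ (Summit.FinalStateConjecture.HasCompleteNullInfinity 𝒟.toCauchyDevelopment ∧ ∃ (O : Set 𝒟.carrier) (d : Literature.Geometry.Lorentzian.FinalStateDecomposition 𝒟.toSpacetime O 2), (∀ i, Literature.Geometry.Lorentzian.Kerr.IsSubextremal (d.mass i) (d.spin i)) ∧ O = Summit.FinalStateConjecture.exteriorOf 𝒟.toCauchyDevelopment d.charted ∧ Summit.FinalStateConjecture.RaysStayInClosure 𝒟.toCauchyDevelopment O ∧ Summit.FinalStateConjecture.HasExhaustiveCharts d ∧ Summit.FinalStateConjecture.IsFutureOriented d) := by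
  sorry

/-! ## §3 The composition (kernel-checked, imported from the landed `CagedComb` file; no `sorry` of its own) -/

/-- **THE CRUX BY NAME** from the three registered stubs: Stub 2's caged carrier becomes an adapted carrier
for an iterate of the period map (`adaptedCombCarrier_of_cagedCombCarrier`), and the landed composition of
the re-typed comb line (`laminatedThreshold_of_adaptedComb_verbatim`, p156269) concludes from Stub 1 and
Stub 3. [folklore] -/
theorem LaminatedThreshold_of :
    Goal.comb_lemma_adapted → Goal.stub_cagedCombCarrier → Goal.stub_nakedNotSettled → LaminatedThreshold :=
  fun hL hC hN ↦ CagedComb.laminatedThreshold_of_cagedComb_verbatim hL hC hN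

/-! ### Consistency: each registered stub, stated EXPANDED, IS the named statement of §1. -/

theorem combLemmaAdapted_holds : CombLemmaAdapted := comb_lemma_adapted
theorem cagedCombCarrier_holds : CagedCombCarrier := stub_cagedCombCarrier
theorem nakedNotSettled_holds : NakedNotSettled := stub_nakedNotSettled

/-- **The crux from the skeleton** (closed modulo the two remaining `sorry`s, Stubs 2 and 3). [folklore] -/
theorem LaminatedThreshold_proof : LaminatedThreshold :=
  LaminatedThreshold_of comb_lemma_adapted stub_cagedCombCarrier stub_nakedNotSettled

end Summit.FinalStateConjecture.FinalStateConjecture.Cruxes.LaminatedThreshold.CagedCombLine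

end
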